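import Summits.Parity.GeneralizedHardyLittlewood.Theorems.GreenTaoLevelTwoMNTwoUniformMajorArc
import Summits.Parity.GeneralizedHardyLittlewood.Theorems.GreenTaoLevelTwoMNTwoBohrGenerators

/-!
# Route `GreenTaoLevelTwo`, crux `MNTwo` (stmt-Parity-21276), line `birth`, stub `stub_mnVertical`:
# §11 chain for the rotation gauge: ONE `q` on the whole Bohr set `B(ρ₃)` (GT 2008b §11, Lemma 28)

Block V5 / H5 of the `stub_mnVertical` census (B. Green, T. Tao, *Quadratic uniformity of the
Möbius function*, Ann. Inst. Fourier 58 (2008) = arXiv:math/0606087, §11, Lemma 28: "there exists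
`ρ₃ ≳ 1` and an integer `q ≲ 1` such that `‖qφ''(h,h')‖ ≲ ‖h‖_g‖h'‖_g` for all
`h, h' ∈ B_g(0,ρ₃)`").  This def-free file specialises the abstract-gauge §11 chain
`…MNTwoUniformMajorArc.uniform_major_arc_of_dense` (Prop. 25 output ⇒ Lemma 26 ⇒ 27 ⇒ 28-alg)
to the ROTATION GAUGE `ν(n) = maxᵢ‖nαᵢ‖ + |n|/N` of the tree's major-arc inverse statement
(`…MNTwoVerticalOfInverseLargeN`, hypothesis `hInv`), feeding it the reduced generators of
`…MNTwoBohrGenerators.exists_bohr_generators` (Lemma 28, geometric half): the output is ONE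
`q ≤ Q₂^{(k+1)²}` with `‖q•φ''(a,b)‖ ≤ K ν(a)ν(b)` for ALL `a, b ∈ B(ρ₂/C_k)` — exactly the shape
of the conclusion of `hInv` (`∃ q K ρ₃, … ∀ a b, ν a < ρ₃ → ν b < ρ₃ → ‖q•φ''(a,b)‖ ≤ K ν a ν b`),
with every parameter explicit (no logarithms yet: `Q, σ, ε, ρ₁, ρ₂` free, subject to the stated
inequalities; `T = B(2ρ₁) ∩ (−N,N)`).

* `uniform_major_arc_rotation` — the statement just described.

References: [GreenTao2008QuadraticMobius] arXiv:math/0606087 §11 (Prop. 25, Lemmas 26–28).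
-/

noncomputable section

open Finset Real

namespace Summit.Parity.GeneralizedHardyLittlewood.GreenTaoLevelTwoMNTwoUniformMajorArcRotation

open Summit.Parity.GeneralizedHardyLittlewood.GreenTaoLevelTwoMNTwoUniformMajorArc
  (uniform_major_arc_of_dense)
open Summit.Parity.GeneralizedHardyLittlewood.GreenTaoLevelTwoMNTwoBohrGenerators
  (exists_bohr_generators)
open Summit.Parity.GeneralizedHardyLittlewood.GreenTaoLevelTwoMNTwoBohrGauge
  (bohrGauge_nonneg bohrGauge_zero bohrGauge_neg bohrGauge_add_le bohrGauge_lt_iff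
  abs_le_mul_bohrGauge)

/-- **GT 2008b §11 (Prop. 25 ⇒ Lemmas 26, 27, 28) for the rotation gauge
`ν(n) = maxᵢ‖nαᵢ‖ + |n|/N`: one `q` on the whole Bohr set.**  There are absolute `A ∈ ℕ`, `C ≥ 1`
such that: for `N ≥ 1`, `α : Fin k → ℝ`, `φ : ℤ → ℝ/ℤ` locally quadratic on `B(n₀,R)` (the eight-point
condition), `0 < ρ₁ ≤ 1/4`, `9ρ₁ ≤ R`, `0 < σ ≤ 1 ≤ Q`, `0 ≤ ε`, `4Qε ≤ σ`, a finite `𝒮 ⊆ B(ρ₁)` with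
`σ·#(B(2ρ₁) ∩ (−N,N)) ≤ #𝒮` all of whose elements `s` have `1 ≤ q_s ≤ Q` with `‖q_s•φ''(s,s)‖ ≤ ε`
(the output of Proposition 25), and `0 < ρ₂` with `18ρ₂ ≤ R`, `648Q₁³K₁ρ₂² ≤ 1`
(`Q₁ = CQ(Q/σ)^A`, `K₁ = C(Q/σ)^A/ρ₁²`), there is ONE `1 ≤ q ≤ (25672Q₁⁶)^{(k+1)²}` such that for
all `a, b` with `ν(a), ν(b) < ρ₂/C_k` (`C_k = 5(k+1)²2^{(k+1)(k+3)}`):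
`‖q•φ''(a,b)‖ ≤ (25672Q₁⁶)^{(k+1)²}·(426133840896·Q₁¹³K₁)·C_k²·ν(a)ν(b)`.
[cite: GreenTao2008QuadraticMobius, §11, Lemma 28] -/
theorem uniform_major_arc_rotation :
    ∃ (A : ℕ) (C : ℝ), 1 ≤ C ∧
      ∀ (k N : ℕ), 1 ≤ N → ∀ (α : Fin k → ℝ) (φ : ℤ → UnitAddCircle) (n₀ : ℤ) (R : ℝ),
        (∀ n a b c : ℤ,
          (⨆ i : Fin k, ‖((((n - n₀ : ℤ) : ℝ) * α i : ℝ) : AddCircle (1 : ℝ))‖) +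
              |((n - n₀ : ℤ) : ℝ)| / N < R →
          (⨆ i : Fin k, ‖((((n + a - n₀ : ℤ) : ℝ) * α i : ℝ) : AddCircle (1 : ℝ))‖) +
              |((n + a - n₀ : ℤ) : ℝ)| / N < R →
          (⨆ i : Fin k, ‖((((n + b - n₀ : ℤ) : ℝ) * α i : ℝ) : AddCircle (1 : ℝ))‖) +
              |((n + b - n₀ : ℤ) : ℝ)| / N < R →
          (⨆ i : Fin k, ‖((((n + c - n₀ : ℤ) : ℝ) * α i : ℝ) : AddCircle (1 : ℝ))‖) +
              |((n + c - n₀ : ℤ) : ℝ)| / N < R →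
          (⨆ i : Fin k, ‖((((n + a + b - n₀ : ℤ) : ℝ) * α i : ℝ) : AddCircle (1 : ℝ))‖) +
              |((n + a + b - n₀ : ℤ) : ℝ)| / N < R →
          (⨆ i : Fin k, ‖((((n + a + c - n₀ : ℤ) : ℝ) * α i : ℝ) : AddCircle (1 : ℝ))‖) +
              |((n + a + c - n₀ : ℤ) : ℝ)| / N < R →
          (⨆ i : Fin k, ‖((((n + b + c - n₀ : ℤ) : ℝ) * α i : ℝ) : AddCircle (1 : ℝ))‖) +
              |((n + b + c - n₀ : ℤ) : ℝ)| / N < R →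
          (⨆ i : Fin k, ‖((((n + a + b + c - n₀ : ℤ) : ℝ) * α i : ℝ) : AddCircle (1 : ℝ))‖) +
              |((n + a + b + c - n₀ : ℤ) : ℝ)| / N < R →
          φ (n + a + b + c) - φ (n + a + b) - φ (n + a + c) - φ (n + b + c)
            + φ (n + a) + φ (n + b) + φ (n + c) - φ n = 0) →
      ∀ (ρ₁ σ ε Q : ℝ) (S : Finset ℤ), 0 < ρ₁ → ρ₁ ≤ 1 / 4 → 9 * ρ₁ ≤ R → 0 < σ → σ ≤ 1 →
        1 ≤ Q → 0 ≤ ε → 4 * Q * ε ≤ σ →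
        (∀ s ∈ S, (⨆ i : Fin k, ‖(((s : ℝ) * α i : ℝ) : AddCircle (1 : ℝ))‖) + |(s : ℝ)| / N < ρ₁) →
        σ * #((Finset.Ioo (-(N : ℤ)) N).filter fun n : ℤ =>
            (∀ i, ‖(((n : ℝ) * α i : ℝ) : AddCircle (1 : ℝ))‖ + |(n : ℝ)| / N < 2 * ρ₁) ∧
              |(n : ℝ)| / N < 2 * ρ₁) ≤ #S →
        (∀ s ∈ S, ∃ q : ℕ, 1 ≤ q ∧ (q : ℝ) ≤ Q ∧
          ‖((q : ℤ)) • (φ (n₀ + s + s) - φ (n₀ + s) - φ (n₀ + s) + φ n₀)‖ ≤ ε) →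
      ∀ (ρ₂ : ℝ), 0 < ρ₂ → 18 * ρ₂ ≤ R →
        648 * (C * Q * (Q / σ) ^ A) ^ 3 * (C * (Q / σ) ^ A / ρ₁ ^ 2) * ρ₂ ^ 2 ≤ 1 →
      ∃ q : ℕ, 1 ≤ q ∧ (q : ℝ) ≤ (25672 * (C * Q * (Q / σ) ^ A) ^ 6) ^ ((k + 1) * (k + 1)) ∧
        ∀ a b : ℤ,
          (⨆ i : Fin k, ‖(((a : ℝ) * α i : ℝ) : AddCircle (1 : ℝ))‖) + |(a : ℝ)| / N <
            ρ₂ / (5 * ((k : ℝ) + 1) ^ 2 * 2 ^ ((k + 1) * (k + 3))) →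
          (⨆ i : Fin k, ‖(((b : ℝ) * α i : ℝ) : AddCircle (1 : ℝ))‖) + |(b : ℝ)| / N <
            ρ₂ / (5 * ((k : ℝ) + 1) ^ 2 * 2 ^ ((k + 1) * (k + 3))) →
          ‖((q : ℤ)) • (φ (n₀ + a + b) - φ (n₀ + a) - φ (n₀ + b) + φ n₀)‖ ≤
            (25672 * (C * Q * (Q / σ) ^ A) ^ 6) ^ ((k + 1) * (k + 1)) *
              (426133840896 * (C * Q * (Q / σ) ^ A) ^ 13 * (C * (Q / σ) ^ A / ρ₁ ^ 2)) *
              (5 * ((k : ℝ) + 1) ^ 2 * 2 ^ ((k + 1) * (k + 3))) ^ 2 *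
              ((⨆ i : Fin k, ‖(((a : ℝ) * α i : ℝ) : AddCircle (1 : ℝ))‖) + |(a : ℝ)| / N) *
              ((⨆ i : Fin k, ‖(((b : ℝ) * α i : ℝ) : AddCircle (1 : ℝ))‖) + |(b : ℝ)| / N) := by
  classical
  obtain ⟨A, C, hC1, hmain⟩ := uniform_major_arc_of_dense
  refine ⟨A, C, hC1, ?_⟩
  intro k N hN α φ n₀ R hφ ρ₁ σ ε Q S hρ₁ hρ₁4 hR9 hσ hσ1 hQ hε hQε hSball hσT hS ρ₂ hρ₂ hR18 hsmall
  have hNpos : (0 : ℝ) < N := by exact_mod_cast hN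
  have hC0 : 0 < C := by linarith
  have hQ0 : 0 < Q := by linarith
  set Ck : ℝ := 5 * ((k : ℝ) + 1) ^ 2 * 2 ^ ((k + 1) * (k + 3)) with hCk
  have hCk0 : 0 < Ck := by rw [hCk]; positivity
  -- the gauge as a function
  obtain ⟨ν, hν⟩ : ∃ ν : ℤ → ℝ, ∀ n : ℤ,
      ν n = (⨆ i : Fin k, ‖(((n : ℝ) * α i : ℝ) : AddCircle (1 : ℝ))‖) + |(n : ℝ)| / N :=
    ⟨_, fun _ => rfl⟩
  have hν0 : ν 0 = 0 := by rw [hν]; exact bohrGauge_zero α N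
  have hνnn : ∀ x, 0 ≤ ν x := fun x => by rw [hν]; exact bohrGauge_nonneg α N x
  have hνneg : ∀ x, ν (-x) = ν x := fun x => by rw [hν, hν]; exact bohrGauge_neg α N x
  have hνadd : ∀ x y, ν (x + y) ≤ ν x + ν y := fun x y => by
    rw [hν, hν, hν]; exact bohrGauge_add_le α N x y
  have hνdef : ∀ x, ν x = 0 → x = 0 := fun x hx => by
    have h1 := abs_le_mul_bohrGauge α hN x
    rw [← hν, hx, mul_zero] at h1
    have h2 : (x : ℝ) = 0 := abs_nonpos_iff.1 h1
    exact_mod_cast h2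
  -- the local quadratic hypothesis in `ν` form
  have hφ' : ∀ n a b c : ℤ, ν (n - n₀) < R → ν (n + a - n₀) < R → ν (n + b - n₀) < R →
      ν (n + c - n₀) < R → ν (n + a + b - n₀) < R → ν (n + a + c - n₀) < R →
      ν (n + b + c - n₀) < R → ν (n + a + b + c - n₀) < R →
      φ (n + a + b + c) - φ (n + a + b) - φ (n + a + c) - φ (n + b + c)
        + φ (n + a) + φ (n + b) + φ (n + c) - φ n = 0 := by
    intro n a b c h1 h2 h3 h4 h5 h6 h7 h8
    rw [hν] at h1 h2 h3 h4 h5 h6 h7 h8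
    exact hφ n a b c h1 h2 h3 h4 h5 h6 h7 h8
  -- `T := B(2ρ₁) ∩ (−N, N)`
  set T := (Finset.Ioo (-(N : ℤ)) N).filter fun n : ℤ =>
    (∀ i, ‖(((n : ℝ) * α i : ℝ) : AddCircle (1 : ℝ))‖ + |(n : ℝ)| / N < 2 * ρ₁) ∧
      |(n : ℝ)| / N < 2 * ρ₁ with hT
  have hmemT : ∀ n : ℤ, ν n < 2 * ρ₁ → n ∈ T := by
    intro n hn
    rw [hν] at hn
    have hn' := (bohrGauge_lt_iff α N n (2 * ρ₁)).1 hn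
    rw [hT, Finset.mem_filter, Finset.mem_Ioo]
    refine ⟨?_, hn'⟩
    have h2 : |(n : ℝ)| / N < 1 := by linarith [hn'.2]
    rw [div_lt_one hNpos] at h2
    have h3 := abs_lt.1 h2
    constructor
    · exact_mod_cast h3.1
    · exact_mod_cast h3.2
  have hTne : T.Nonempty := ⟨0, hmemT 0 (by rw [hν0]; linarith)⟩
  have hTball : ∀ n ∈ T, ν n < 2 * ρ₁ := by
    intro n hn
    rw [hT, Finset.mem_filter] at hn
    rw [hν]; exact (bohrGauge_lt_iff α N n (2 * ρ₁)).2 hn.2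
  have hTS : ∀ m : ℤ, ν m ≤ ρ₁ → ∀ s ∈ S, s - m ∈ T := by
    intro m hm s hs
    apply hmemT
    have h1 : ν s < ρ₁ := by rw [hν]; exact hSball s hs
    have h2 : ν (s - m) ≤ ν s + ν (-m) := by rw [sub_eq_add_neg]; exact hνadd s (-m)
    rw [hνneg] at h2
    linarith
  -- generators of `B(ρ₂)` (Lemma 28, geometric half)
  obtain ⟨v, hvball, hvrep⟩ := exists_bohr_generators k hN α hρ₂
  have hvball' : ∀ j, ν (v j) < ρ₂ := fun j => by rw [hν]; exact hvball j
  -- the abstract §11 chain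
  obtain ⟨q, hq1, hqQ, hqb⟩ := hmain ν hν0 hνnn hνneg hνadd hνdef φ n₀ R hφ' ρ₁ σ ε Q S T hρ₁ hR9
    hσ hσ1 hQ hε hQε hTne hTball hTS hσT hS ρ₂ hR18 hsmall (k + 1) v hvball'
  refine ⟨q, hq1, hqQ, fun a b ha hb => ?_⟩
  obtain ⟨c, hca, hcb⟩ := hvrep a ha
  obtain ⟨c', hc'a, hc'b⟩ := hvrep b hb
  have hcb' : ∑ j, |(c j : ℝ)| * ν (v j) ≤ Ck * ν a := by simp only [hν]; exact hcb
  have hc'b' : ∑ j, |(c' j : ℝ)| * ν (v j) ≤ Ck * ν b := by simp only [hν]; exact hc'b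
  have ha' : Ck * ν a < ρ₂ := by
    have h := ha; rw [← hν, lt_div_iff₀ hCk0] at h; linarith
  have hb' : Ck * ν b < ρ₂ := by
    have h := hb; rw [← hν, lt_div_iff₀ hCk0] at h; linarith
  have key := hqb c c' (lt_of_le_of_lt hcb' ha') (lt_of_le_of_lt hc'b' hb')
  rw [← hca, ← hc'a] at key
  refine key.trans ?_
  have hQσ : 0 < Q / σ := div_pos hQ0 hσ
  have hX0 : 0 ≤ (25672 * (C * Q * (Q / σ) ^ A) ^ 6) ^ ((k + 1) * (k + 1)) *
      (426133840896 * (C * Q * (Q / σ) ^ A) ^ 13 * (C * (Q / σ) ^ A / ρ₁ ^ 2)) := by positivity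
  have hS1 : 0 ≤ ∑ j, |(c' j : ℝ)| * ν (v j) :=
    Finset.sum_nonneg fun j _ => mul_nonneg (abs_nonneg _) (hνnn _)
  have hprod : (∑ j, |(c j : ℝ)| * ν (v j)) * (∑ j, |(c' j : ℝ)| * ν (v j)) ≤
      (Ck * ν a) * (Ck * ν b) :=
    mul_le_mul hcb' hc'b' hS1 (mul_nonneg hCk0.le (hνnn a))
  calc (25672 * (C * Q * (Q / σ) ^ A) ^ 6) ^ ((k + 1) * (k + 1)) *
        (426133840896 * (C * Q * (Q / σ) ^ A) ^ 13 * (C * (Q / σ) ^ A / ρ₁ ^ 2)) *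
        (∑ j, |(c j : ℝ)| * ν (v j)) * (∑ j, |(c' j : ℝ)| * ν (v j))
      = (25672 * (C * Q * (Q / σ) ^ A) ^ 6) ^ ((k + 1) * (k + 1)) *
        (426133840896 * (C * Q * (Q / σ) ^ A) ^ 13 * (C * (Q / σ) ^ A / ρ₁ ^ 2)) *
        ((∑ j, |(c j : ℝ)| * ν (v j)) * (∑ j, |(c' j : ℝ)| * ν (v j))) := by ring
    _ ≤ (25672 * (C * Q * (Q / σ) ^ A) ^ 6) ^ ((k + 1) * (k + 1)) *
        (426133840896 * (C * Q * (Q / σ) ^ A) ^ 13 * (C * (Q / σ) ^ A / ρ₁ ^ 2)) *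
        ((Ck * ν a) * (Ck * ν b)) := mul_le_mul_of_nonneg_left hprod hX0
    _ = (25672 * (C * Q * (Q / σ) ^ A) ^ 6) ^ ((k + 1) * (k + 1)) *
        (426133840896 * (C * Q * (Q / σ) ^ A) ^ 13 * (C * (Q / σ) ^ A / ρ₁ ^ 2)) *
        Ck ^ 2 * ν a * ν b := by ring
    _ = _ := by rw [hν a, hν b]

end Summit.Parity.GeneralizedHardyLittlewood.GreenTaoLevelTwoMNTwoUniformMajorArcRotation
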